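import Summits.FinalStateConjecture.FinalStateConjecture.Theorems.BartnikGapSettlingBondiBartnikRigidityRouteMarchingDefs
import Summits.FinalStateConjecture.FinalStateConjecture.Theorems.BartnikGapSettlingBondiBartnikRigidityKerrLateBoxPlacement
import HarnessLib

/-!
# K2b-1 `SlabFutureContainsCylinder` (stub `stub_slabFutureContainsCylinder`) — line
# `direct-method-on-the-cone` (crux `BondiBartnikRigidity`, stmt-FinalStateConjecture-10807)

In the Kerr star chart `Kerr.spacetime M a M` (`{r > M}`, ingoing Kerr–Schild Cartesian coordinates,
`0 < M`, `|a| < M`) the causal future of the thick slab `slabK = {t* = 0, r ≤ 3M}` contains the solid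
cylinder `{t* ≥ 0, r ≤ 3M}` over it: the route statement `K2Route.SlabFutureContainsCylinder`, the
first of the two explicit Kerr causal-geometry facts consumed by the marching route to the corrected F5.

Proof (explicit straight timelike lines of the flat coordinates, the tools of F6
`…KerrLateBoxPlacement`; no ODEs).  Let `y` be a chart point with `t*(y) ≥ 0` and `M < r(y) ≤ 3M`.
If `t*(y) = 0` then `y ∈ slab ⊆ J⁺(slab)`.  If `t*(y) > 0` then `y ∈ I⁺(slab) ⊆ J⁺(slab)`:
* for `r(y) > 2M` the two-leg chain `mem_chronologicalFuture_slabK` with the VERTICAL direction `∂₀`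
  (`λ = 0`; `g(∂₀, ∂₀) = −1 + 2H < 0` since `H ≤ M/r < 1/2`) and the shell point `y − (t*(y)/2) ∂₀` of
  radius `r(y) ∈ (2M, 3M]`;
* for `M < r(y) ≤ 2M` the INGOING direction `w = ∂₀ − ℓ♯` (`λ = −1`, `w⁰ = 2`, `g(w, w) = −3 + 2H < 0`
  on `{r > 2M/3}`), along whose backward line the radius INCREASES at unit rate (`kerrLine_radius`):
  if `r(y) + t*(y)/2 ≤ 3M` the backward line reaches `{t* = 0}` at the slab point `y − (t*(y)/2) w` of
  radius `r(y) + t*(y)/2 ∈ (M, 3M]` and ONE straight timelike chart segment realises `≪`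
  (`mem_chronologicalFuture_of_segment`); otherwise stop on the shell `r = 5M/2 ∈ (2M, 3M]` after the
  parameter `S = 5M/2 − r(y) > 0`, where `2S = 5M − 2r(y) < 6M − 2r(y) < t*(y)`, and conclude by
  `mem_chronologicalFuture_slabK` (`λ = −1`).

References: Dafermos–Rodnianski arXiv:0811.0354, §5.1 (the Kerr star chart, `∇t*` timelike)
[DafermosRodnianski2008]; Kerr–Schild 1965, §2 (the principal null congruence is straight in the flat
background) [KerrSchild1965]; O'Neill 1983, Ch. 14, pp. 402–403 (`S ⊆ J⁺(S)`, `I⁺ ⊆ J⁺`) [ONeill1983];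
O'Neill 1995, Ch. 4 [ONeill1995].
-/

noncomputable section

-- D-0017: single-problem summit, `Summit.<S>.<S>.…` by design (cf. lakefile `weak.linter.dupNamespace`).
set_option linter.dupNamespace false
-- instance search through the nested operator types of the Kerr chart facts
set_option maxSynthPendingDepth 3

open Set Filter Function Topology TopologicalSpace
open Literature.Geometry.Lorentzian
open scoped Manifold ContDiff Topology

namespace Summit.FinalStateConjecture.FinalStateConjecture.Theorems.BondiBartnikRigidity.DirectMethod

namespace KerrLateBox

/-- **One ingoing leg from the slab.**  If the chart point `y` (`M < r(y)`) has `t*(y) > 0` and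
`r(y) + t*(y)/2 ≤ 3M`, then `y ∈ I⁺(slab)`: the backward straight line `y + s w`, `w = ∂₀ − ℓ♯_y`,
`s ∈ [−t*(y)/2, 0]`, has radius `r(y) − s ∈ [r(y), r(y) + t*(y)/2] ⊆ (M, 3M]` (so it stays in the chart
and `w` is `g`-timelike along it, `g(w, w) = −3 + 2H`, `H ≤ M/r`), time coordinate `t*(y) + 2s`, and
starts at the slab point `y − (t*(y)/2) w`; a straight timelike chart segment with `w⁰ = 2 > 0`
realises `≪` (`mem_chronologicalFuture_of_segment`). [cite: DafermosRodnianski2008, §5.1] -/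
theorem mem_chronologicalFuture_slabK_of_ingoing [Kerr.Facts] {M a : ℝ} (hM : 0 < M)
    (y : Kerr.region a M) (ht : 0 < (y : E4) 0)
    (hr : Kerr.radius a y + (y : E4) 0 / 2 ≤ 3 * M) :
    y ∈ (Kerr.smoothMetric M a M).chronologicalFuture
      ((Kerr.timeOrientation M a M hM.le).ofLE le_top) (slabK M a) := by
  have hy : 0 < Kerr.radius a y := Kerr.radius_pos_of_mem_region y.2
  have hyM : M < Kerr.radius a y := Kerr.lt_radius_of_mem_region y.2
  set S : ℝ := (y : E4) 0 / 2 with hS_def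
  have hS : 0 < S := by linarith
  set w : E4 := E4.basisVector 0 + (-1 : ℝ) • Kerr.nullVector a y with hw
  -- radius and chart membership along the backward line `y + s w`, `s ≤ 0`
  have hrad : ∀ s : ℝ, s ≤ 0 → Kerr.radius a ((y : E4) + s • w) = Kerr.radius a y - s :=
    fun s hs ↦ by
    rw [hw, (kerrLine_radius hy (-1) s (by linarith)).1]
    ring
  have hmem : ∀ s : ℝ, s ≤ 0 → (y : E4) + s • w ∈ Kerr.region a M := fun s hs ↦ by
    rw [Kerr.mem_region, max_eq_left hM.le, hrad s hs]
    linarith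
  -- the slab point `p = y - S w`
  set p : Kerr.region a M := ⟨(y : E4) + (-S) • w, hmem (-S) (by linarith)⟩
  have hpslab : p ∈ slabK M a := by
    constructor
    · show ((y : E4) + (-S) • w) 0 = 0
      rw [hw, kerrLine_apply_zero]
      linarith
    · show Kerr.radius a ((y : E4) + (-S) • w) ≤ 3 * M
      rw [hrad (-S) (by linarith)]
      linarith
  have hshift : ∀ s : ℝ, (p : E4) + s • w = (y : E4) + (s - S) • w := fun s ↦ by
    show ((y : E4) + (-S) • w) + s • w = _
    rw [add_assoc, ← add_smul]
    ring_nf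
  have h0 : (0 : ℝ) < w 0 := by
    rw [hw]
    norm_num [Kerr.nullVector_apply_zero]
  refine LorentzianMetric.chronologicalFuture_mono (singleton_subset_iff.2 hpslab) ?_
  refine mem_chronologicalFuture_of_segment hM p y w hS (by rw [hshift]; simp) (fun s hs ↦ ?_)
    (fun s hs ↦ ?_) h0
  · rw [hshift]
    exact hmem (s - S) (by linarith [hs.2])
  · rw [hshift, hw]
    exact kerrLine_bilin_neg hM hy (-1) (s - S) (by linarith [hs.2]) (by nlinarith [hs.2])

/-- **The solid cylinder over the slab lies in `I⁺(slab)` above the slab**: every chart point `y`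
with `t*(y) > 0` and `r(y) ≤ 3M` (and `r(y) > M`, being in the chart) is in `I⁺(slab)` — for
`r(y) > 2M` by the vertical `∂₀`-line down to the slab (`mem_chronologicalFuture_slabK`, `λ = 0`),
for `M < r(y) ≤ 2M` by the ingoing line `∂₀ − ℓ♯` either directly to the slab
(`mem_chronologicalFuture_slabK_of_ingoing`, when `r(y) + t*(y)/2 ≤ 3M`) or up to the shell
`r = 5M/2` and then vertically (`mem_chronologicalFuture_slabK`, `λ = −1`, `S = 5M/2 − r(y)`,
`2S < t*(y)`). [cite: DafermosRodnianski2008, §5.1] -/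
theorem mem_chronologicalFuture_slabK_of_pos [Kerr.Facts] {M a : ℝ} (hM : 0 < M)
    (y : Kerr.region a M) (ht : 0 < (y : E4) 0) (hr : Kerr.radius a y ≤ 3 * M) :
    y ∈ (Kerr.smoothMetric M a M).chronologicalFuture
      ((Kerr.timeOrientation M a M hM.le).ofLE le_top) (slabK M a) := by
  have hyM : M < Kerr.radius a y := Kerr.lt_radius_of_mem_region y.2
  rcases lt_or_ge (2 * M) (Kerr.radius a (y : E4)) with h2 | h2
  · -- vertical leg, `λ = 0`, shell point `y - (t*(y)/2) ∂₀`
    exact mem_chronologicalFuture_slabK hM y (l := 0) (S := (y : E4) 0 / 2) (by norm_num)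
      (by linarith) (fun s _ ↦ by linarith) (fun s _ ↦ by nlinarith) (by linarith) (by linarith)
      (by linarith)
  rcases le_or_gt (Kerr.radius a (y : E4) + (y : E4) 0 / 2) (3 * M) with h3 | h3
  · -- one ingoing leg straight down to the slab
    exact mem_chronologicalFuture_slabK_of_ingoing hM y ht h3
  · -- ingoing leg, `λ = -1`, back up to the shell `r = 5M/2`
    exact mem_chronologicalFuture_slabK hM y (l := -1) (S := 5 * M / 2 - Kerr.radius a (y : E4))
      (by norm_num) (by linarith) (fun s hs ↦ by linarith [hs.2]) (fun s hs ↦ by nlinarith [hs.2])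
      (by linarith) (by linarith) (by linarith)

/-- **The solid cylinder `{t* ≥ 0, M < r ≤ 3M}` lies in `J⁺(slab)`** (set form of
`K2Route.SlabFutureContainsCylinder` for the bundled star spacetime): the base `{t* = 0}` is the slab
itself (`S ⊆ J⁺(S)`), the rest is in `I⁺(slab) ⊆ J⁺(slab)` (`mem_chronologicalFuture_slabK_of_pos`).
[cite: DafermosRodnianski2008, §5.1] -/
theorem cylinder_subset_JK [Kerr.Facts] {M a : ℝ} (hM : 0 < M) :
    {y : Kerr.region a M | 0 ≤ y.1 0 ∧ Kerr.radius a y.1 ≤ 3 * M} ⊆ JK M a hM (slabK M a) := by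
  rintro y ⟨ht, hr⟩
  change y ∈ (Kerr.smoothMetric M a M).causalFuture ((Kerr.timeOrientation M a M hM.le).ofLE le_top)
    (slabK M a)
  rcases ht.eq_or_lt with h0 | h0
  · exact LorentzianMetric.subset_causalFuture _ _ _ ⟨h0.symm, hr⟩
  · exact LorentzianMetric.chronologicalFuture_subset_causalFuture _ _ _
      (mem_chronologicalFuture_slabK_of_pos hM y h0 hr)

end KerrLateBox

open KerrLateBox in
/-- **Registered sub-goal `stub_slabFutureContainsCylinder` (K2b-1, `K2Route.SlabFutureContainsCylinder`).**
In the Kerr star chart `{r > M}`, `0 < M`, `|a| < M`: the causal future of the thick slab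
`{t* = 0, r ≤ 3M}` contains the solid cylinder `{t* ≥ 0, r ≤ 3M}` over it — explicit straight timelike
lines of the Kerr–Schild chart (`cylinder_subset_JK`; the hypothesis `|a| < M` is not needed).
[cite: DafermosRodnianski2008, §5.1] -/
theorem stub_slabFutureContainsCylinder : K2Route.SlabFutureContainsCylinder := by
  intro _ M a hM _
  exact cylinder_subset_JK hM

end Summit.FinalStateConjecture.FinalStateConjecture.Theorems.BondiBartnikRigidity.DirectMethod

end
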